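/-
Copyright (c) 2026 the pub-hodgecm-mathlib formalisation cell (harness21).  Prover seat hodgecm-mathlib-A-p19 (g27), 2026-09-01.  Road «S3-tree»∕«S3-ram» (LEAD F0P3a-plan (g12)
T11-41∕T11-52; owner p06 (g15)), row (e2) «P-2-ram», organ «L1-ram RANK 3»: the rank-three twin of ★ A-p06 (g27) `UnitaryGroupSelfDualLocusRamified{,Place}` (rank two) over the rank-three
engine ★ F0P3a-p08 (g18) `HermitianUnimodularRankThreeRamified`.
-/
import Literature.NumberTheory.Automorphic.UnitaryGroupSelfDualLocusRamifiedPlace    -- ★ A-p06 (g27) rank 2: `valuation_det_eq_one_of_formCongr_mem_glInt` (any `n`), `exists_mul_map_eq_of_map_eq_of_sub_one_mem`; brings ★ inert `UnitaryGroupSelfDualLocus` (`exists_mem_glInt_coe_eq_formCongr`, `exists_mem_unitaryGroupOfForm_mul_of_formCongr_eq`), ★ `valued_galAdicCompletionMap_sub_lt_one_of_ramified`, ★ `Kramer1981.henselianLocalRing_integer`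
import Literature.NumberTheory.QuadraticForms.HermitianUnimodularRankThreeRamified  -- ★ p846881 F0P3a-p08 (g18): `HermitianUnimodularRamified.exists_formCongr_eq_of_det_eq_mul_norm_three`
import HarnessLib

/-!
# The self-dual locus of `GL₃(E_w)` is `U(J)(E_w) · GL₃(𝒪_w)` at a TAMELY RAMIFIED place: the unitary group of a unimodular hermitian form in THREE variables over a
# quadratic extension with residually trivial conjugation is transitive on self-dual lattices (Jacobowitz 1962, §8)

Topic `NumberTheory/Automorphic`; namespace `Literature.NumberTheory.Automorphic.UnitaryGroup`.  KERNEL ONLY: theorems, no definition, no instance, no notation, no named fact,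
no `sorry`.  Cell `pub/hodgecm-mathlib` (D-0151), crux H413 = `stmt-HodgeConjecture-24833`; road «S3-tree», seeding wave «S3-ram» (tame-ramified non-split `v ∤ 2`), row (e2) «P-2-ram»
(the type-(2) share of `stub_levelOneRowsRam`); organ **«L1-ram RANK 3»** (this seat).  HONEST LABEL: HC_CM is proved only modulo the 2 remaining named inputs (hLiu418 24832, h413 24833)
until rung 0 closes; nothing printed is asserted here.

WHY.  The inert one-place chain of the type-(2) free row — ★ [T2-a] `CyclicSelfDualLatticeTorsor.ncard_setOf_selfDual_cyclic_eq_relIndex` (F0P3b-p01 (g12)) and the ★ seam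
`RationalCyclicSelfDualLattices.exists_selfDual_cyclic_iff_exists_rational_good` (B-p14 (g37)) — consumes the dictionary ★ `exists_mem_unitaryGroupOfForm_mul_iff`
(`UnitaryGroupSelfDualLocus`, INERT signature: «every `σ`-fixed unit is a norm», false at a ramified place).  ★ A-p06 (g27) re-cut that dictionary for hermitian PLANES in the
RAMIFIED signature ((two) `2 ∈ 𝒪^×`, (res) `σ r − r ∈ 𝔪`, (norm₁) `σ`-fixed principal units are norms, finite residue field) over the rank-2 determinant-class engine; this file
is the RANK-3 twin over ★ `HermitianUnimodularRamified.exists_formCongr_eq_of_det_eq_mul_norm_three` (unimodular hermitian `3 × 3` Gram matrices over such a local ring are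
congruent iff their determinants agree modulo norms — and two Gram matrices of the SAME space `(E³, J)` differ in determinant by the norm `det g · σ(det g)`, `det g ∈ 𝒪^×`).
The proofs are ★ A-p06's, with `Fin 2 ↦ Fin 3` and the engine swapped.

* §1 **`exists_mem_unitaryGroupOfForm_mul_of_selfDual_of_detClass_three`** (hypothesis-driven: any valued field `E`, `σ` an `𝒪`- and valuation-preserving involution with
  (two), (res), (norm₁) on `𝒪[E]`, `𝓀[E]` finite): `J ∈ GL₃(𝒪)` `σ`-hermitian and `(σg)ᵀ J g ∈ GL₃(𝒪)` ⇒ `g = u k`, `u ∈ U(J)(E)`, `k ∈ GL₃(𝒪)`; the dictionary form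
  **`exists_mem_unitaryGroupOfForm_mul_iff_of_detClass_three`**.
* §2 at a tamely ramified non-split place `w ∣ v` of a quadratic extension of number fields `E ∕ F` (`c • w = w`, `c ≠ 1`, `e(w|v) ≠ 1`, `2 ∈ 𝒪_w^×`), `σ_w = galAdicCompletionMap c hw`:
  **`exists_mem_unitaryGroupOfForm_mul_of_selfDual_of_ramified_three`** and the dictionary **`exists_mem_unitaryGroupOfForm_mul_iff_of_ramified_three`** — the ramified companions
  of ★ `exists_mem_unitaryGroupOfForm_mul_of_selfDual_of_nonsplit` ∕ `exists_mem_unitaryGroupOfForm_mul_iff` in rank `3` ((res) ★ `valued_galAdicCompletionMap_sub_lt_one_of_ramified`,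
  (norm₁) ★ `exists_mul_map_eq_of_map_eq_of_sub_one_mem` in the Henselian `𝒪_w`).

## References
* [Jacobowitz1962] R. Jacobowitz, *Hermitian forms over local fields*, Amer. J. Math. 84 (1962), §8 (ramified non-dyadic unimodular lattices: classified by rank and discriminant).
* [Kottwitz1992] R. E. Kottwitz, *Points on some Shimura varieties over finite fields*, JAMS 5 (1992), §7 Lemma 7.2, Cor. 7.3 (the `u k` decomposition).
* [Omeara1963] O. T. O'Meara, *Introduction to Quadratic Forms* (1963), §92:1–2.
-/

set_option autoImplicit false

open NumberField IsDedekindDomain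
open scoped Matrix ValuativeRel
open ValuativeRel

namespace Literature.NumberTheory.Automorphic.UnitaryGroup

open Literature.NumberTheory.Automorphic Literature.NumberTheory.QuadraticForms

/-! ## §1 The `u k` decomposition in rank three from the determinant-class engine -/

section DetClass

variable {E : Type*} [Field E] [ValuativeRel E] (σ : E →+* E)

/-- **`U(J)(E)` IS TRANSITIVE ON SELF-DUAL LATTICES OF A HERMITIAN SPACE OF RANK THREE, ramified signature** (hypothesis-driven).  `E` a valued field, `σ` an involution
preserving `𝒪 = 𝒪[E]` and the valuation, with, on `𝒪`: (two) `2 ∈ 𝒪^×`, (res) `σ r − r ∈ 𝔪` (residually trivial conjugation — the RAMIFIED signature), (norm₁) every `σ`-fixed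
principal unit is a norm `t σ t`, and `𝓀[E]` finite.  If `J ∈ GL₃(𝒪)` is `σ`-hermitian and the Gram matrix `(σg)ᵀ J g` of `g ∈ GL₃(E)` lies in `GL₃(𝒪)` (the lattice `g 𝒪³` is
self-dual), then `g = u k` with `u ∈ U(J)(E)` and `k ∈ GL₃(𝒪)` — via the engine ★ `exists_formCongr_eq_of_det_eq_mul_norm_three` at `t = det g` (a unit by ★
`valuation_det_eq_one_of_formCongr_mem_glInt`). [cite: Jacobowitz1962, §8] [cite: Kottwitz1992, §7 Lemma 7.2, Cor. 7.3] [cite: Omeara1963, §92:1–2] -/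
theorem exists_mem_unitaryGroupOfForm_mul_of_selfDual_of_detClass_three (hσσ : ∀ x, σ (σ x) = x) (hσO : ∀ x : 𝒪[E], σ x ∈ 𝒪[E])
    (hσv : ∀ x : E, valuation E (σ x) = valuation E x) [Finite 𝓀[E]]
    (h2 : IsUnit (2 : 𝒪[E])) (hres : ∀ r : 𝒪[E], (⟨σ r, hσO r⟩ : 𝒪[E]) - r ∈ IsLocalRing.maximalIdeal 𝒪[E])
    (hnorm₁ : ∀ u : 𝒪[E], σ u = u → u - 1 ∈ IsLocalRing.maximalIdeal 𝒪[E] → ∃ t : 𝒪[E], (t : E) * σ t = u)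
    (J : GL (Fin 3) E) (hJ : J ∈ glInt 3 E) (hJh : ((J : Matrix (Fin 3) (Fin 3) E).map σ)ᵀ = J)
    (g : GL (Fin 3) E) (hg : ∃ J' ∈ glInt 3 E, (J' : Matrix (Fin 3) (Fin 3) E) = formCongr σ g (J : Matrix (Fin 3) (Fin 3) E)) :
    ∃ u ∈ unitaryGroupOfForm σ (J : Matrix (Fin 3) (Fin 3) E), ∃ k ∈ glInt 3 E, g = u * k := by
  classical
  -- `det g ∈ 𝒪^×`
  have hdetg : valuation E (g : Matrix (Fin 3) (Fin 3) E).det = 1 := valuation_det_eq_one_of_formCongr_mem_glInt σ hσv J hJ g hg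
  obtain ⟨J', hJ', hgJ⟩ := hg
  obtain ⟨J₀, rfl⟩ := hJ
  obtain ⟨J₀', rfl⟩ := hJ'
  set τ : 𝒪[E] →+* 𝒪[E] := (σ.comp (𝒪[E]).subtype).codRestrict (𝒪[E]) fun x => hσO x with hτdef
  have hτ : ∀ x, τ (τ x) = x := fun x => Subtype.ext (hσσ x)
  have hcomp : ⇑(𝒪[E]).subtype ∘ ⇑τ = ⇑σ ∘ ⇑(𝒪[E]).subtype := funext fun _ => rfl
  have hinj : Function.Injective (fun M : Matrix (Fin 3) (Fin 3) 𝒪[E] => M.map (𝒪[E]).subtype) :=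
    Matrix.map_injective Subtype.val_injective
  have hcoe : ∀ M₀ : GL (Fin 3) 𝒪[E], ((Matrix.GeneralLinearGroup.map (𝒪[E]).subtype M₀ : GL (Fin 3) E) : Matrix (Fin 3) (Fin 3) E) =
      (M₀ : Matrix (Fin 3) (Fin 3) 𝒪[E]).map (𝒪[E]).subtype := fun _ => rfl
  -- hermitian-ness over `𝒪` is inherited from `E`
  have hherm : ∀ M₀ : GL (Fin 3) 𝒪[E],
      ((((Matrix.GeneralLinearGroup.map (𝒪[E]).subtype M₀ : GL (Fin 3) E) : Matrix (Fin 3) (Fin 3) E)).map σ)ᵀ =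
        (Matrix.GeneralLinearGroup.map (𝒪[E]).subtype M₀ : GL (Fin 3) E) →
      ((M₀ : Matrix (Fin 3) (Fin 3) 𝒪[E]).map τ)ᵀ = M₀ := by
    intro M₀ hM₀
    apply hinj
    change (((M₀ : Matrix (Fin 3) (Fin 3) 𝒪[E]).map τ)ᵀ).map _ = (M₀ : Matrix (Fin 3) (Fin 3) 𝒪[E]).map _
    rw [Matrix.transpose_map, Matrix.map_map, hcomp, ← Matrix.map_map, ← hcoe]
    exact hM₀
  have hJ₀h : ((J₀ : Matrix (Fin 3) (Fin 3) 𝒪[E]).map τ)ᵀ = J₀ := hherm J₀ hJh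
  have hJ₀'h : ((J₀' : Matrix (Fin 3) (Fin 3) 𝒪[E]).map τ)ᵀ = J₀' := by
    refine hherm J₀' ?_
    rw [hgJ]
    exact formCongr_hermitian σ hσσ g hJh
  -- the engine's hypotheses on `𝒪[E]`, in `τ`-form
  have hres' : ∀ r : 𝒪[E], τ r - r ∈ IsLocalRing.maximalIdeal 𝒪[E] := hres
  have hnorm₁' : ∀ u : 𝒪[E], τ u = u → u - 1 ∈ IsLocalRing.maximalIdeal 𝒪[E] → ∃ t : 𝒪[E], t * τ t = u := by
    intro u hu h1
    obtain ⟨t, ht⟩ := hnorm₁ u (congrArg Subtype.val hu) h1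
    exact ⟨t, Subtype.ext ht⟩
  haveI : Finite (IsLocalRing.ResidueField 𝒪[E]) := ‹Finite 𝓀[E]›
  -- the determinant class: `det J₀' = det J₀ · (t τ t)`, `t = det g ∈ 𝒪`
  have hdetg' : (g : Matrix (Fin 3) (Fin 3) E).det ∈ 𝒪[E] := (Valuation.mem_integer_iff _ _).2 hdetg.le
  set t : 𝒪[E] := ⟨(g : Matrix (Fin 3) (Fin 3) E).det, hdetg'⟩ with htdef
  have hdetrel : (J₀' : Matrix (Fin 3) (Fin 3) 𝒪[E]).det = (J₀ : Matrix (Fin 3) (Fin 3) 𝒪[E]).det * (t * τ t) := by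
    apply Subtype.val_injective
    have h1 : (((J₀' : Matrix (Fin 3) (Fin 3) 𝒪[E]).det : 𝒪[E]) : E) = ((J₀' : Matrix (Fin 3) (Fin 3) 𝒪[E]).map (𝒪[E]).subtype).det := by
      rw [← RingHom.mapMatrix_apply, ← RingHom.map_det]; rfl
    have h2 : (((J₀ : Matrix (Fin 3) (Fin 3) 𝒪[E]).det : 𝒪[E]) : E) = ((J₀ : Matrix (Fin 3) (Fin 3) 𝒪[E]).map (𝒪[E]).subtype).det := by
      rw [← RingHom.mapMatrix_apply, ← RingHom.map_det]; rfl
    change (((J₀' : Matrix (Fin 3) (Fin 3) 𝒪[E]).det : 𝒪[E]) : E) = ((J₀ : Matrix (Fin 3) (Fin 3) 𝒪[E]).det : E) * ((t : E) * σ (t : E))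
    rw [h1, h2, ← hcoe, ← hcoe, hgJ, HermitianUnimodularRamified.det_formCongr]
  -- the engine over `𝒪` (rank three)
  obtain ⟨T₀, hT₀⟩ := HermitianUnimodularRamified.exists_formCongr_eq_of_det_eq_mul_norm_three τ hτ h2 hres' hnorm₁'
    (J₀ : Matrix (Fin 3) (Fin 3) 𝒪[E]) (J₀' : Matrix (Fin 3) (Fin 3) 𝒪[E]) hJ₀h (Matrix.isUnits_det_units J₀) hJ₀'h (Matrix.isUnits_det_units J₀')
    t hdetrel
  -- push the congruence forward along `𝒪 ↪ E`
  refine exists_mem_unitaryGroupOfForm_mul_of_formCongr_eq σ _ g (Matrix.GeneralLinearGroup.map (𝒪[E]).subtype T₀) ⟨T₀, rfl⟩ ?_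
  rw [← hgJ, hcoe J₀', ← hT₀, hcoe J₀]
  simp only [formCongr, Matrix.map_mul, Matrix.transpose_map, Matrix.map_map, hcomp]
  rfl

/-- **The dictionary `U(J)(E) ∕ K ≅ {self-dual lattices}` in rank three, ramified signature**: under the hypotheses of
`exists_mem_unitaryGroupOfForm_mul_of_selfDual_of_detClass_three`, `g ∈ GL₃(E)` factors as `u k` (`u ∈ U(J)`, `k ∈ GL₃(𝒪)`) IFF its Gram matrix lies in `GL₃(𝒪)`.
[cite: Jacobowitz1962, §8] [cite: Kottwitz1992, §7 Cor. 7.3] -/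
theorem exists_mem_unitaryGroupOfForm_mul_iff_of_detClass_three (hσσ : ∀ x, σ (σ x) = x) (hσO : ∀ x : 𝒪[E], σ x ∈ 𝒪[E])
    (hσv : ∀ x : E, valuation E (σ x) = valuation E x) [Finite 𝓀[E]]
    (h2 : IsUnit (2 : 𝒪[E])) (hres : ∀ r : 𝒪[E], (⟨σ r, hσO r⟩ : 𝒪[E]) - r ∈ IsLocalRing.maximalIdeal 𝒪[E])
    (hnorm₁ : ∀ u : 𝒪[E], σ u = u → u - 1 ∈ IsLocalRing.maximalIdeal 𝒪[E] → ∃ t : 𝒪[E], (t : E) * σ t = u)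
    (J : GL (Fin 3) E) (hJ : J ∈ glInt 3 E) (hJh : ((J : Matrix (Fin 3) (Fin 3) E).map σ)ᵀ = J) (g : GL (Fin 3) E) :
    (∃ u ∈ unitaryGroupOfForm σ (J : Matrix (Fin 3) (Fin 3) E), ∃ k ∈ glInt 3 E, g = u * k) ↔
      ∃ J' ∈ glInt 3 E, (J' : Matrix (Fin 3) (Fin 3) E) = formCongr σ g (J : Matrix (Fin 3) (Fin 3) E) := by
  refine ⟨?_, exists_mem_unitaryGroupOfForm_mul_of_selfDual_of_detClass_three σ hσσ hσO hσv h2 hres hnorm₁ J hJ hJh g⟩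
  rintro ⟨u, hu, k, hk, rfl⟩
  obtain ⟨J', hJ', hJ'eq⟩ := exists_mem_glInt_coe_eq_formCongr σ hσO J hJ k hk
  refine ⟨J', hJ', ?_⟩
  rw [hJ'eq, formCongr_mul_eq_formCongr_formCongr, show formCongr σ u (J : Matrix (Fin 3) (Fin 3) E) = J from
    mem_unitaryGroupOfForm_iff.1 hu]

end DetClass

/-! ## §2 At a tamely ramified non-split place `w ∣ v` of a quadratic extension of number fields -/

section NumberField

variable {F E : Type} [Field F] [NumberField F] [Field E] [NumberField E] [Algebra F E]
  [Algebra.IsQuadraticExtension F E] (c : E ≃ₐ[F] E) {v : HeightOneSpectrum (𝓞 F)} (w : PlacesOver E v)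

/-- **`U(J)(E_w)` is transitive on self-dual `𝒪_w`-lattices of a hermitian space of RANK THREE at a TAMELY RAMIFIED place** (`e(w|v) ≠ 1`; `w ∣ v` with `c • w = w`, `c ≠ 1`;
tame: `2 ∈ 𝒪_w^×`), for the local Galois involution `σ_w = galAdicCompletionMap c hw` and a `σ_w`-hermitian `J ∈ GL₃(𝒪_w)`: every `g ∈ GL₃(E_w)` with `(σ_w g)ᵀ J g ∈ GL₃(𝒪_w)` is
`u k`, `u ∈ U(J)(E_w)`, `k ∈ GL₃(𝒪_w)` (§1 with (res) ★ `valued_galAdicCompletionMap_sub_lt_one_of_ramified`, (norm₁) ★ `exists_mul_map_eq_of_map_eq_of_sub_one_mem` in the Henselian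
`𝒪_w`, `𝓀_w` finite ★) — the ramified rank-3 companion of ★ `exists_mem_unitaryGroupOfForm_mul_of_selfDual_of_nonsplit`. [cite: Jacobowitz1962, §8] [cite: Kottwitz1992, §7 Cor. 7.3] -/
theorem exists_mem_unitaryGroupOfForm_mul_of_selfDual_of_ramified_three (hc1 : c ≠ 1) (hw : c • w.1 = w.1)
    (he : v.asIdeal.ramificationIdx' w.1.asIdeal ≠ 1) (h2 : IsUnit (2 : 𝒪[w.1.adicCompletion E]))
    (J : GL (Fin 3) (w.1.adicCompletion E)) (hJ : J ∈ glInt 3 (w.1.adicCompletion E))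
    (hJh : ((J : Matrix (Fin 3) (Fin 3) (w.1.adicCompletion E)).map (galAdicCompletionMap (L := E) c hw))ᵀ = J)
    (g : GL (Fin 3) (w.1.adicCompletion E))
    (hg : ∃ J' ∈ glInt 3 (w.1.adicCompletion E), (J' : Matrix (Fin 3) (Fin 3) (w.1.adicCompletion E)) =
      formCongr (galAdicCompletionMap (L := E) c hw) g (J : Matrix (Fin 3) (Fin 3) (w.1.adicCompletion E))) :
    ∃ u ∈ unitaryGroupOfForm (galAdicCompletionMap (L := E) c hw) (J : Matrix (Fin 3) (Fin 3) (w.1.adicCompletion E)),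
      ∃ k ∈ glInt 3 (w.1.adicCompletion E), g = u * k := by
  classical
  set K := w.1.adicCompletion E
  set σ := galAdicCompletionMap (L := E) c hw with hσdef
  haveI : HenselianLocalRing 𝒪[K] := Literature.NumberTheory.EllipticCurves.Kramer1981.henselianLocalRing_integer
  have hσσ : ∀ x, σ (σ x) = x := galAdicCompletionMap_galAdicCompletionMap_of_smul_eq c w hc1 hw
  have hσO : ∀ x : 𝒪[K], σ x ∈ 𝒪[K] := fun x => mem_integer_galAdicCompletionMap c v w hw x
  have hσv : ∀ x : K, valuation K (σ x) = valuation K x := fun x => valuation_galAdicCompletionMap_eq c v w hw x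
  -- the bridge `𝔪_w = {valuation < 1} = {Valued.v < 1}`
  have hmem : ∀ x : 𝒪[K], x ∈ IsLocalRing.maximalIdeal 𝒪[K] ↔ Valued.v (x : K) < 1 := fun x => by
    rw [← IsLocalRing.residue_eq_zero_iff, residue_eq_zero_iff_valuation_lt_one, ← Valuation.vlt_one_iff (valuation K),
      Valuation.vlt_one_iff (Valued.v : Valuation K (WithZero (Multiplicative ℤ)))]
  have hle : ∀ x : 𝒪[K], Valued.v (x : K) ≤ 1 := fun x => by
    rw [← Valuation.vle_one_iff (Valued.v : Valuation K (WithZero (Multiplicative ℤ))), Valuation.vle_one_iff (valuation K)]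
    exact (Valuation.mem_integer_iff _ _).1 x.2
  -- (res)
  have hres : ∀ r : 𝒪[K], (⟨σ r, hσO r⟩ : 𝒪[K]) - r ∈ IsLocalRing.maximalIdeal 𝒪[K] := fun r => by
    rw [hmem]
    exact Liu2021.LemD1IndexedNonVacuityRamifiedConverse.valued_galAdicCompletionMap_sub_lt_one_of_ramified E c v hc1 w hw he (r : K) (hle r)
  -- (norm₁)
  set τ : 𝒪[K] →+* 𝒪[K] := (σ.comp (𝒪[K]).subtype).codRestrict (𝒪[K]) fun x => hσO x with hτdef
  have hresτ : ∀ r : 𝒪[K], τ r - r ∈ IsLocalRing.maximalIdeal 𝒪[K] := hres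
  have hnorm₁ : ∀ u : 𝒪[K], σ u = u → u - 1 ∈ IsLocalRing.maximalIdeal 𝒪[K] → ∃ t : 𝒪[K], (t : K) * σ t = u := by
    intro u hu h1
    obtain ⟨t, ht⟩ := exists_mul_map_eq_of_map_eq_of_sub_one_mem τ h2 hresτ u (Subtype.ext hu) h1
    exact ⟨t, congrArg Subtype.val ht⟩
  exact exists_mem_unitaryGroupOfForm_mul_of_selfDual_of_detClass_three σ hσσ hσO hσv h2 hres hnorm₁ J hJ hJh g hg

/-- **The dictionary `U(J)(E_w) ∕ U(J)(𝒪_w) ≅ {self-dual lattices}` of RANK THREE at a tamely ramified non-split place**: `g ∈ GL₃(E_w)` factors as `u k` (`u ∈ U(J)(E_w)`,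
`k ∈ GL₃(𝒪_w)`) IFF `(σ_w g)ᵀ J g ∈ GL₃(𝒪_w)` — the ramified twin of ★ `exists_mem_unitaryGroupOfForm_mul_iff` in the shape consumed by ★ [T2-a] `CyclicSelfDualLatticeTorsor` and the
★ seam `RationalCyclicSelfDualLattices`. [cite: Jacobowitz1962, §8] [cite: Kottwitz1992, §7 Cor. 7.3] -/
theorem exists_mem_unitaryGroupOfForm_mul_iff_of_ramified_three (hc1 : c ≠ 1) (hw : c • w.1 = w.1)
    (he : v.asIdeal.ramificationIdx' w.1.asIdeal ≠ 1) (h2 : IsUnit (2 : 𝒪[w.1.adicCompletion E]))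
    (J : GL (Fin 3) (w.1.adicCompletion E)) (hJ : J ∈ glInt 3 (w.1.adicCompletion E))
    (hJh : ((J : Matrix (Fin 3) (Fin 3) (w.1.adicCompletion E)).map (galAdicCompletionMap (L := E) c hw))ᵀ = J)
    (g : GL (Fin 3) (w.1.adicCompletion E)) :
    (∃ u ∈ unitaryGroupOfForm (galAdicCompletionMap (L := E) c hw) (J : Matrix (Fin 3) (Fin 3) (w.1.adicCompletion E)),
      ∃ k ∈ glInt 3 (w.1.adicCompletion E), g = u * k) ↔
      ∃ J' ∈ glInt 3 (w.1.adicCompletion E), (J' : Matrix (Fin 3) (Fin 3) (w.1.adicCompletion E)) =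
        formCongr (galAdicCompletionMap (L := E) c hw) g (J : Matrix (Fin 3) (Fin 3) (w.1.adicCompletion E)) := by
  refine ⟨?_, exists_mem_unitaryGroupOfForm_mul_of_selfDual_of_ramified_three c w hc1 hw he h2 J hJ hJh g⟩
  have hσO : ∀ x : 𝒪[w.1.adicCompletion E], galAdicCompletionMap (L := E) c hw x ∈ 𝒪[w.1.adicCompletion E] := fun x =>
    mem_integer_galAdicCompletionMap c v w hw x
  rintro ⟨u, hu, k, hk, rfl⟩
  obtain ⟨J', hJ', hJ'eq⟩ := exists_mem_glInt_coe_eq_formCongr (galAdicCompletionMap (L := E) c hw) hσO J hJ k hk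
  refine ⟨J', hJ', ?_⟩
  rw [hJ'eq, formCongr_mul_eq_formCongr_formCongr,
    show formCongr (galAdicCompletionMap (L := E) c hw) u (J : Matrix (Fin 3) (Fin 3) (w.1.adicCompletion E)) = J from mem_unitaryGroupOfForm_iff.1 hu]

end NumberField

end Literature.NumberTheory.Automorphic.UnitaryGroup
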